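import Summits.CriticalPhenomena.SAWScalingLimit.Theorems.SAWDefectDecoherenceBoundaryClosureRPickEnginePotentialByParts
import Summits.CriticalPhenomena.SAWScalingLimit.Theorems.SAWDefectDecoherenceBoundaryClosureRPickEngineMidEdgeCover
import Summits.CriticalPhenomena.SAWScalingLimit.Theorems.SAWDefectDecoherenceBoundaryClosureRPickEngineWeakDbarLocal
import HarnessLib

/-!
# The developing map against test functions: summation by parts at a fixed mesh
(crux `BoundaryClosureR`, stmt-CriticalPhenomena-14004, line `pick-half-plane`,
stub `stub_developingMapLimitHolomorphic`; lattice bookkeeping at ONE scale, no limits)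

Let `hh : Site 2 → ℂ` have the increments `hh(spoke s k) − hh(s) = m_k · δ G(edge s k)` at the
interior sites of `S` (the normalised developing map of a potential of `F dz`, `G = F/F(b)`), let
`φ ∈ C²_c` (Lipschitz constant `L`, Taylor constant `M`), and let `w : Fin 6 → ℂ` be weights of
norm `≤ 1` with the FRAME IDENTITY `Σ_k w_k · 12 conj(m_k) · (P D_k + Q conj D_k) = A P + B Q`
(`frame_sum_inv`: `w = 1`, `(A, B) = (12(2ζ−1), 0)`; `frame_sum_conj_inv`: `w = conj u`,
`(A, B) = (0, −12)`).  Then (`byParts_estimate`, registered helper)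
`‖Σ_T Σ_k φ(δ·mid(edge s k)) w_k G(edge s k) + Σ_T hh(s)(A ∂φ + B ∂̄φ)(δ s)‖ ≤
(Lδ/2) Σ_T Σ_k 1[δ·mid ∈ K_δ] ‖G‖ + 24 M δ Σ_T 1[δ s ∈ K_δ] ‖hh s‖`, `K_δ` the closed
`δ`-neighbourhood of `tsupport φ`: Abel summation (`pickEngine_potentialByParts`), first-order
Taylor expansion in Wirtinger form, the frame identity; plus the interiority criterion for sites
and the cover bound for the first error term.  References: Duminil-Copin–Smirnov (2012) §3.
-/

noncomputable section

open scoped BigOperators ComplexConjugate Topology NNReal Classical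
open Finset Set Metric Complex
open Literature.Probability.LatticeModels Literature.Probability.RandomPlanarGeometry
open Literature.Probability.RandomPlanarGeometry.SAW
open Literature.Barriers.CriticalPhenomena Literature.Barriers.CriticalPhenomena.HexKernel
open Literature.Analysis.Complex (dbarAlong dbarAlong_one)
open Summit.CriticalPhenomena.SAWScalingLimit.Theorems.PickHalfPlane
open Summit.CriticalPhenomena.SAWScalingLimit.Theorems.PickHalfPlane.Hexagon
open Summit.CriticalPhenomena.SAWScalingLimit.Theorems.PickHalfPlane.Engine
open Summit.CriticalPhenomena.SAWScalingLimit.Theorems.MassRatio.Negative (hexDomainMidEdges_finite)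

namespace Summit.CriticalPhenomena.SAWScalingLimit.Theorems.PickHalfPlane.DevelopingMap

/-! ### Sites versus the centres of their faces -/

/-- A site is within distance `1` (indeed `1/√3`) of the centre of each face containing it.
[folklore] -/
theorem norm_hexCenter_sub_triEmbed_le {f : HexVertex} {s : Site 2} (hs : s ∈ hexFaceVertices f) :
    ‖hexCenter f - triEmbed s‖ ≤ 1 := by
  have h3 : Real.sqrt 3 * Real.sqrt 3 = 3 := Real.mul_self_sqrt (by norm_num)
  have hsq : ‖hexCenter f - triEmbed s‖ ^ 2 ≤ 1 := by
    rw [← Complex.normSq_eq_norm_sq]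
    obtain ⟨y, i⟩ := f
    have hi : i = 0 ∨ i = 1 := by fin_cases i <;> simp
    rcases hi with rfl | rfl
    · rw [mem_hexFaceVertices_zero] at hs
      rcases hs with rfl | rfl | rfl <;>
        simp [hexCenter_mk, triEmbed_add, Complex.normSq_apply] <;> nlinarith [h3]
    · rw [mem_hexFaceVertices_one] at hs
      rcases hs with rfl | rfl | rfl <;>
        simp [hexCenter_mk, triEmbed_add, Complex.normSq_apply] <;> nlinarith [h3]
  nlinarith [norm_nonneg (hexCenter f - triEmbed s)]

/-- **Interiority criterion** (scaled): if every face `f` with `‖δ c_f − δ s‖ ≤ δ` lies in `Λ`,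
the site `s` is interior. [folklore] -/
theorem isInteriorSite_of_scaled {Λ : Finset HexVertex} {s : Site 2} {δ : ℝ} (hδ : 0 < δ)
    (h : ∀ f : HexVertex, ‖(δ : ℂ) * hexCenter f - (δ : ℂ) * triEmbed s‖ ≤ δ → f ∈ Λ) :
    IsInteriorSite Λ s := by
  refine fun f hf => h f ?_
  rw [← mul_sub, norm_mul, Complex.norm_real, Real.norm_eq_abs, abs_of_pos hδ]
  exact (mul_le_mul_of_nonneg_left (norm_hexCenter_sub_triEmbed_le hf) hδ.le).trans
    (le_of_eq (mul_one δ))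

/-- The scaled mid-edge of the `k`-th hexagon edge is at distance `δ/2` from the scaled site.
[folklore] -/
theorem norm_scaled_hexMidpoint_edge_sub (s : Site 2) (k : Fin 6) (δ : ℝ) :
    ‖(δ : ℂ) * hexMidpoint (edge s k) - (δ : ℂ) * triEmbed s‖ = |δ| / 2 := by
  rw [hexMidpoint_edge_eq, ← mul_sub, add_sub_cancel_left, norm_mul, Complex.norm_real,
    Real.norm_eq_abs, norm_div, norm_triEmbed_spoke_zero, Complex.norm_two]
  ring

/-! ### Taylor expansion against the hexagon frame -/

/-- **First-order Taylor bound with quadratic remainder** for `φ ∈ C²` of compact support: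
`‖φ(z + h) − φ(z) − Dφ(z)h‖ ≤ M ‖h‖²` (the derivative is Lipschitz). [folklore] -/
theorem taylor_bound {φ : ℂ → ℂ} (hφ : ContDiff ℝ 2 φ) (hφc : HasCompactSupport φ) :
    ∃ M : ℝ, 0 ≤ M ∧ ∀ z h : ℂ, ‖φ (z + h) - φ z - fderiv ℝ φ z h‖ ≤ M * ‖h‖ ^ 2 := by
  -- adapted from `HexObservableLimitR.greenLimit_taylor_two` (C³ there; C² suffices)
  have hd : ContDiff ℝ 1 (fderiv ℝ φ) := hφ.fderiv_right (by norm_num)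
  obtain ⟨K, hK⟩ := hd.lipschitzWith_of_hasCompactSupport (hφc.fderiv ℝ) one_ne_zero
  have hdiff : Differentiable ℝ φ := hφ.differentiable (by norm_num)
  refine ⟨K, K.2, fun z h => ?_⟩
  have key := (convex_closedBall z ‖h‖).norm_image_sub_le_of_norm_hasFDerivWithin_le
    (f := fun y => φ y - fderiv ℝ φ z y) (f' := fun y => fderiv ℝ φ y - fderiv ℝ φ z)
    (x := z) (y := z + h) (C := K * ‖h‖)
    (fun y _ => ((hdiff y).hasFDerivAt.sub (fderiv ℝ φ z).hasFDerivAt).hasFDerivWithinAt)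
    (fun y hy => by
      rw [← dist_eq_norm]
      exact (hK.dist_le_mul y z).trans (by gcongr; exact mem_closedBall.1 hy))
    (mem_closedBall_self (norm_nonneg h)) (by simp [mem_closedBall, dist_eq_norm])
  have e : (φ (z + h) - fderiv ℝ φ z (z + h)) - (φ z - fderiv ℝ φ z z) =
      φ (z + h) - φ z - fderiv ℝ φ z h := by
    rw [map_add]; ring
  rw [e, add_sub_cancel_left] at key
  calc ‖φ (z + h) - φ z - fderiv ℝ φ z h‖ ≤ K * ‖h‖ * ‖h‖ := key
    _ = K * ‖h‖ ^ 2 := by ring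

/-- **The frame/Taylor estimate at one site.** For `φ` with Taylor constant `M`, weights `w` of
norm `≤ 1` satisfying the frame identity with constants `(A, B)`, and every `z`, `δ`:
`‖Σ_k w_k 12conj(m_k)(φ(z) − φ(z − δD_k)) − δ(A ∂φ(z) + B ∂̄φ(z))‖ ≤ 24 M δ²`. [folklore] -/
theorem frame_taylor {φ : ℂ → ℂ} {M : ℝ}
    (hM : ∀ z h : ℂ, ‖φ (z + h) - φ z - fderiv ℝ φ z h‖ ≤ M * ‖h‖ ^ 2)
    (w : Fin 6 → ℂ) (hw : ∀ k, ‖w k‖ ≤ 1) (A B : ℂ)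
    (hframe : ∀ P Q : ℂ, ∑ k : Fin 6, w k * (12 * conj (mvec k)) *
      (P * triEmbed (spoke 0 k) + Q * conj (triEmbed (spoke 0 k))) = A * P + B * Q)
    (z : ℂ) (δ : ℝ) :
    ‖∑ k : Fin 6, w k * (12 * conj (mvec k)) * (φ z - φ (z - (δ : ℂ) * triEmbed (spoke 0 k))) -
        (δ : ℂ) * (A * ((2 : ℂ)⁻¹ * (fderiv ℝ φ z 1 - I * fderiv ℝ φ z I)) + B * dbarAlong 1 φ z)‖ ≤
      24 * M * δ ^ 2 := by
  set P : ℂ := (2 : ℂ)⁻¹ * (fderiv ℝ φ z 1 - I * fderiv ℝ φ z I) with hP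
  set Q : ℂ := dbarAlong 1 φ z with hQ
  -- the remainders
  set R : Fin 6 → ℂ := fun k => φ (z + (-(δ : ℂ) * triEmbed (spoke 0 k))) - φ z -
    fderiv ℝ φ z (-(δ : ℂ) * triEmbed (spoke 0 k)) with hR
  have hRle : ∀ k, ‖R k‖ ≤ M * δ ^ 2 := fun k => by
    have := hM z (-(δ : ℂ) * triEmbed (spoke 0 k))
    rw [norm_mul, norm_neg, Complex.norm_real, Real.norm_eq_abs, norm_triEmbed_spoke_zero,
      mul_one, sq_abs] at this
    exact this
  -- the increments in Wirtinger form
  have hinc : ∀ k, φ z - φ (z - (δ : ℂ) * triEmbed (spoke 0 k)) =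
      (δ : ℂ) * (P * triEmbed (spoke 0 k) + Q * conj (triEmbed (spoke 0 k))) - R k := by
    intro k
    have hD : fderiv ℝ φ z (-(δ : ℂ) * triEmbed (spoke 0 k)) =
        -((δ : ℂ) * (P * triEmbed (spoke 0 k) + Q * conj (triEmbed (spoke 0 k)))) := by
      rw [fderiv_apply_eq_wirtinger, map_mul, map_neg, Complex.conj_ofReal, hP, hQ]; ring
    have hz : z - (δ : ℂ) * triEmbed (spoke 0 k) = z + -(δ : ℂ) * triEmbed (spoke 0 k) := by ring
    rw [hz, hR]
    simp only [hD]
    ring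
  -- sum: frame identity plus remainders
  have hsum : ∑ k : Fin 6, w k * (12 * conj (mvec k)) * (φ z - φ (z - (δ : ℂ) * triEmbed (spoke 0 k))) -
      (δ : ℂ) * (A * P + B * Q) = -∑ k : Fin 6, w k * (12 * conj (mvec k)) * R k := by
    simp only [hinc, mul_sub, Finset.sum_sub_distrib]
    have h1 : ∑ k : Fin 6, w k * (12 * conj (mvec k)) *
        ((δ : ℂ) * (P * triEmbed (spoke 0 k) + Q * conj (triEmbed (spoke 0 k)))) =
        (δ : ℂ) * (A * P + B * Q) := by
      rw [← hframe P Q, Finset.mul_sum]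
      exact Finset.sum_congr rfl fun k _ => by ring
    rw [h1]; ring
  rw [hsum, norm_neg]
  calc ‖∑ k : Fin 6, w k * (12 * conj (mvec k)) * R k‖
      ≤ ∑ k : Fin 6, ‖w k * (12 * conj (mvec k)) * R k‖ := norm_sum_le _ _
    _ ≤ ∑ _k : Fin 6, 1 * 4 * (M * δ ^ 2) := Finset.sum_le_sum fun k _ => by
        rw [norm_mul, norm_mul]
        have h0 : 0 ≤ M * δ ^ 2 := (norm_nonneg _).trans (hRle k)
        gcongr
        · exact hw k
        · exact norm_twelve_conj_mvec_le k
        · exact hRle k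
    _ = 24 * M * δ ^ 2 := by simp; ring

/-- Far from the support everything vanishes: if `z ∉ K_δ := cthickening δ (tsupport φ)`
(`0 ≤ δ`), then the six increments `φ(z) − φ(z − δD_k)` and the derivative `Dφ(z)` are zero.
[folklore] -/
theorem frame_eq_zero_of_notMem {φ : ℂ → ℂ} {z : ℂ} {δ : ℝ} (hδ : 0 ≤ δ)
    (hz : z ∉ cthickening δ (tsupport φ)) (k : Fin 6) :
    φ z - φ (z - (δ : ℂ) * triEmbed (spoke 0 k)) = 0 ∧ fderiv ℝ φ z = 0 := by
  have hzK : z ∉ tsupport φ := fun h => hz (self_subset_cthickening _ h)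
  have hz' : z - (δ : ℂ) * triEmbed (spoke 0 k) ∉ tsupport φ := by
    intro h
    refine hz (mem_cthickening_of_dist_le _ _ _ _ h ?_)
    rw [dist_eq_norm, sub_sub_cancel, norm_mul, Complex.norm_real, Real.norm_eq_abs,
      norm_triEmbed_spoke_zero, mul_one, abs_of_nonneg hδ]
  refine ⟨by rw [image_eq_zero_of_notMem_tsupport hzK, image_eq_zero_of_notMem_tsupport hz',
    sub_zero], ?_⟩
  by_contra hne
  exact hzK (support_fderiv_subset ℝ (Function.mem_support.2 hne))

/-- The frame/Taylor estimate with the support indicator: the defect at `z` is bounded by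
`24 M δ²` if `z ∈ K_δ` and vanishes otherwise. [folklore] -/
theorem frame_taylor_indicator {φ : ℂ → ℂ} {M : ℝ}
    (hM : ∀ z h : ℂ, ‖φ (z + h) - φ z - fderiv ℝ φ z h‖ ≤ M * ‖h‖ ^ 2)
    (w : Fin 6 → ℂ) (hw : ∀ k, ‖w k‖ ≤ 1) (A B : ℂ)
    (hframe : ∀ P Q : ℂ, ∑ k : Fin 6, w k * (12 * conj (mvec k)) *
      (P * triEmbed (spoke 0 k) + Q * conj (triEmbed (spoke 0 k))) = A * P + B * Q)
    (z : ℂ) {δ : ℝ} (hδ : 0 ≤ δ) [Decidable (z ∈ cthickening δ (tsupport φ))] :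
    ‖∑ k : Fin 6, w k * (12 * conj (mvec k)) * (φ z - φ (z - (δ : ℂ) * triEmbed (spoke 0 k))) -
        (δ : ℂ) * (A * ((2 : ℂ)⁻¹ * (fderiv ℝ φ z 1 - I * fderiv ℝ φ z I)) + B * dbarAlong 1 φ z)‖ ≤
      if z ∈ cthickening δ (tsupport φ) then 24 * M * δ ^ 2 else 0 := by
  split_ifs with hz
  · exact frame_taylor hM w hw A B hframe z δ
  · have h0 := fun k => (frame_eq_zero_of_notMem hδ hz k).1
    have hD := (frame_eq_zero_of_notMem hδ hz 0).2
    simp [h0, dbarAlong_one, hD]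

/-! ### Abel summation with weights -/

/-- **Weighted summation by parts for the developing map.** If `hh(spoke s k) − hh(s) =
m_k · F'(edge s k)` at the interior sites of `S` and the coefficient `c` is supported on
interior sites `s` with `s, spoke s k ∈ T`, then
`Σ_{s∈T} c(s) Σ_k w_k F'(edge s k) = −Σ_{s∈T} hh(s) Σ_k w_k 12conj(m_k) (c(s) − c(s − d_k))`.
[folklore] -/
theorem byParts_weighted (S : Finset HexVertex) (T : Finset (Site 2)) (F' : Sym2 HexVertex → ℂ)
    (hh c : Site 2 → ℂ) (w : Fin 6 → ℂ)
    (hHF : ∀ (s : Site 2) (k : Fin 6), IsInteriorSite S s → hh (spoke s k) - hh s = mvec k * F' (edge s k))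
    (hc : ∀ s : Site 2, c s ≠ 0 → IsInteriorSite S s ∧ s ∈ T ∧ ∀ k, spoke s k ∈ T) :
    ∑ s ∈ T, c s * ∑ k : Fin 6, w k * F' (edge s k) =
      -∑ s ∈ T, hh s * ∑ k : Fin 6, w k * (12 * conj (mvec k)) * (c s - c (s - spoke 0 k)) := by
  have hk : ∀ k : Fin 6, ∑ s ∈ T, c s * (mvec k * F' (edge s k)) =
      -∑ s ∈ T, (c s - c (s - spoke 0 k)) * hh s := fun k =>
    pickEngine_potentialByParts S T F' hh c k (fun s hs => hHF s k hs)
      (fun s hs => ⟨(hc s hs).1, (hc s hs).2.1, (hc s hs).2.2 k⟩)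
  calc ∑ s ∈ T, c s * ∑ k : Fin 6, w k * F' (edge s k)
      = ∑ k : Fin 6, w k * (12 * conj (mvec k)) * ∑ s ∈ T, c s * (mvec k * F' (edge s k)) := by
        simp only [Finset.mul_sum]
        rw [Finset.sum_comm]
        refine Finset.sum_congr rfl fun k _ => Finset.sum_congr rfl fun s _ => ?_
        have h := mvec_mul_twelve_conj k
        linear_combination (-(c s * w k * F' (edge s k))) * h
    _ = ∑ k : Fin 6, w k * (12 * conj (mvec k)) * -∑ s ∈ T, (c s - c (s - spoke 0 k)) * hh s := by
        simp only [hk]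
    _ = -∑ s ∈ T, hh s * ∑ k : Fin 6, w k * (12 * conj (mvec k)) * (c s - c (s - spoke 0 k)) := by
        simp only [mul_neg, Finset.sum_neg_distrib, Finset.mul_sum]
        rw [Finset.sum_comm]
        refine congrArg Neg.neg (Finset.sum_congr rfl fun s _ => Finset.sum_congr rfl fun k _ => ?_)
        ring

/-! ### Replacing mid-edge evaluations by site evaluations -/

/-- **Midpoint replacement.** For `L`-Lipschitz `φ` and weights of norm `≤ 1`:
`‖Σ_{s∈T}Σ_k (φ(δ·mid(edge s k)) − φ(δ s)) w_k G(edge s k)‖ ≤ (Lδ/2)·Σ_{s∈T}Σ_k 1[δ·mid ∈ K_δ]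
‖G(edge s k)‖`, `K_δ = cthickening δ (tsupport φ)` (terms off `K_δ` vanish). [folklore] -/
theorem midpoint_replace {φ : ℂ → ℂ} {L : ℝ≥0} (hL : LipschitzWith L φ) (w : Fin 6 → ℂ)
    (hw : ∀ k, ‖w k‖ ≤ 1) (T : Finset (Site 2)) (G : Sym2 HexVertex → ℂ) {δ : ℝ} (hδ : 0 ≤ δ)
    [DecidablePred (· ∈ cthickening δ (tsupport φ))] :
    ‖∑ s ∈ T, ∑ k : Fin 6, (φ ((δ : ℂ) * hexMidpoint (edge s k)) - φ ((δ : ℂ) * triEmbed s)) *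
        w k * G (edge s k)‖ ≤
      (L : ℝ) * δ / 2 * ∑ s ∈ T, ∑ k : Fin 6,
        (if (δ : ℂ) * hexMidpoint (edge s k) ∈ cthickening δ (tsupport φ) then ‖G (edge s k)‖ else 0) := by
  rw [Finset.mul_sum]
  refine (norm_sum_le _ _).trans (Finset.sum_le_sum fun s _ => ?_)
  rw [Finset.mul_sum]
  refine (norm_sum_le _ _).trans (Finset.sum_le_sum fun k _ => ?_)
  have hdist : ‖(δ : ℂ) * hexMidpoint (edge s k) - (δ : ℂ) * triEmbed s‖ = δ / 2 := by
    rw [norm_scaled_hexMidpoint_edge_sub, abs_of_nonneg hδ]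
  by_cases hm : (δ : ℂ) * hexMidpoint (edge s k) ∈ cthickening δ (tsupport φ)
  · rw [if_pos hm, norm_mul, norm_mul]
    have hlip : ‖φ ((δ : ℂ) * hexMidpoint (edge s k)) - φ ((δ : ℂ) * triEmbed s)‖ ≤ L * (δ / 2) := by
      rw [← dist_eq_norm, ← hdist, ← dist_eq_norm]
      exact hL.dist_le_mul _ _
    calc ‖φ ((δ : ℂ) * hexMidpoint (edge s k)) - φ ((δ : ℂ) * triEmbed s)‖ * ‖w k‖ * ‖G (edge s k)‖
        ≤ L * (δ / 2) * 1 * ‖G (edge s k)‖ := by gcongr; exact hw k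
      _ = L * δ / 2 * ‖G (edge s k)‖ := by ring
  · rw [if_neg hm, mul_zero]
    have h1 : φ ((δ : ℂ) * hexMidpoint (edge s k)) = 0 :=
      image_eq_zero_of_notMem_tsupport fun h => hm (self_subset_cthickening _ h)
    have h2 : φ ((δ : ℂ) * triEmbed s) = 0 := by
      refine image_eq_zero_of_notMem_tsupport fun h => hm ?_
      refine mem_cthickening_of_dist_le _ _ _ _ h ?_
      rw [dist_eq_norm, hdist]; linarith
    rw [h1, h2, sub_zero, zero_mul, zero_mul, norm_zero]

/-! ### The estimate at a fixed mesh -/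

/-- **Summation by parts for the normalised developing map against a test function (registered
helper `developingMapLimitHolomorphic_byParts` of stub `stub_developingMapLimitHolomorphic`,
fixed mesh).**  See the module docstring: with `hh` the normalised developing map (increments
`m_k · δ G(edge s k)` at interior sites of `S`), `φ` with Lipschitz constant `L` and Taylor
constant `M`, weights `w` (`‖w_k‖ ≤ 1`) with frame constants `(A, B)`, and a set of sites `T`
containing, together with its spokes, every site whose scaled position lies in
`K_δ = cthickening δ (tsupport φ)`, all of them interior:
`‖Σ_T Σ_k φ(δ mid) w_k G + Σ_T hh·(A∂φ + B∂̄φ)(δs)‖ ≤ (Lδ/2)Σ_T Σ_k 1[δ mid ∈ K_δ]‖G‖ +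
24Mδ Σ_T 1[δ s ∈ K_δ]‖hh s‖`. [folklore] -/
theorem byParts_estimate (S : Finset HexVertex) (T : Finset (Site 2)) (G : Sym2 HexVertex → ℂ)
    (hh : Site 2 → ℂ) (φ : ℂ → ℂ) {L : ℝ≥0} {M δ : ℝ} (w : Fin 6 → ℂ) (A B : ℂ)
    (hHF : ∀ (s : Site 2) (k : Fin 6), IsInteriorSite S s →
      hh (spoke s k) - hh s = mvec k * ((δ : ℂ) * G (edge s k)))
    (hL : LipschitzWith L φ)
    (hM : ∀ z h : ℂ, ‖φ (z + h) - φ z - fderiv ℝ φ z h‖ ≤ M * ‖h‖ ^ 2)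
    (hw : ∀ k, ‖w k‖ ≤ 1)
    (hframe : ∀ P Q : ℂ, ∑ k : Fin 6, w k * (12 * conj (mvec k)) *
      (P * triEmbed (spoke 0 k) + Q * conj (triEmbed (spoke 0 k))) = A * P + B * Q)
    (hδ : 0 < δ)
    (hT : ∀ s : Site 2, (δ : ℂ) * triEmbed s ∈ cthickening δ (tsupport φ) →
      IsInteriorSite S s ∧ s ∈ T ∧ ∀ k, spoke s k ∈ T)
    [DecidablePred (· ∈ cthickening δ (tsupport φ))] :
    ‖∑ s ∈ T, ∑ k : Fin 6, φ ((δ : ℂ) * hexMidpoint (edge s k)) * w k * G (edge s k) +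
        ∑ s ∈ T, hh s * (A * ((2 : ℂ)⁻¹ * (fderiv ℝ φ ((δ : ℂ) * triEmbed s) 1 -
          I * fderiv ℝ φ ((δ : ℂ) * triEmbed s) I)) + B * dbarAlong 1 φ ((δ : ℂ) * triEmbed s))‖ ≤
      (L : ℝ) * δ / 2 * ∑ s ∈ T, ∑ k : Fin 6,
          (if (δ : ℂ) * hexMidpoint (edge s k) ∈ cthickening δ (tsupport φ) then ‖G (edge s k)‖ else 0) +
        24 * M * δ * ∑ s ∈ T,
          (if (δ : ℂ) * triEmbed s ∈ cthickening δ (tsupport φ) then ‖hh s‖ else 0) := by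
  -- notation
  set c : Site 2 → ℂ := fun s => φ ((δ : ℂ) * triEmbed s) with hc
  set Dφ : Site 2 → ℂ := fun s => A * ((2 : ℂ)⁻¹ * (fderiv ℝ φ ((δ : ℂ) * triEmbed s) 1 -
    I * fderiv ℝ φ ((δ : ℂ) * triEmbed s) I)) + B * dbarAlong 1 φ ((δ : ℂ) * triEmbed s) with hDφ
  set Y : Site 2 → ℂ := fun s => ∑ k : Fin 6, w k * (12 * conj (mvec k)) * (c s - c (s - spoke 0 k))
    with hY
  set X : ℂ := ∑ s ∈ T, ∑ k : Fin 6, φ ((δ : ℂ) * hexMidpoint (edge s k)) * w k * G (edge s k)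
    with hX
  set X₀ : ℂ := ∑ s ∈ T, c s * ∑ k : Fin 6, w k * G (edge s k) with hX₀
  -- (1) midpoint replacement: `X = X₀ + E₁`
  have hE₁ := midpoint_replace hL w hw T G hδ.le
  have hXX₀ : X - X₀ = ∑ s ∈ T, ∑ k : Fin 6,
      (φ ((δ : ℂ) * hexMidpoint (edge s k)) - φ ((δ : ℂ) * triEmbed s)) * w k * G (edge s k) := by
    rw [hX, hX₀, ← Finset.sum_sub_distrib]
    refine Finset.sum_congr rfl fun s _ => ?_
    rw [Finset.mul_sum, ← Finset.sum_sub_distrib]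
    refine Finset.sum_congr rfl fun k _ => ?_
    simp only [hc]; ring
  -- (2) Abel: `X₀ = -(1/δ) Σ hh · Y`
  have hsupp : ∀ s : Site 2, c s ≠ 0 → IsInteriorSite S s ∧ s ∈ T ∧ ∀ k, spoke s k ∈ T := by
    intro s hs
    refine hT s (self_subset_cthickening _ ?_)
    exact subset_tsupport _ (Function.mem_support.2 hs)
  have hAbel : X₀ = -(δ : ℂ)⁻¹ * ∑ s ∈ T, hh s * Y s := by
    have h := byParts_weighted S T (fun z => (δ : ℂ) * G z) hh c w hHF hsupp
    have hδ0 : (δ : ℂ) ≠ 0 := Complex.ofReal_ne_zero.2 hδ.ne'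
    have hX₀' : ∑ s ∈ T, c s * ∑ k : Fin 6, w k * ((δ : ℂ) * G (edge s k)) = (δ : ℂ) * X₀ := by
      rw [hX₀, Finset.mul_sum]
      refine Finset.sum_congr rfl fun s _ => ?_
      rw [Finset.mul_sum, Finset.mul_sum, Finset.mul_sum]
      exact Finset.sum_congr rfl fun k _ => by ring
    rw [hX₀'] at h
    calc X₀ = (δ : ℂ)⁻¹ * ((δ : ℂ) * X₀) := by field_simp
      _ = -(δ : ℂ)⁻¹ * ∑ s ∈ T, hh s * Y s := by rw [h]; ring
  -- (3) Taylor/frame at each site: `Y s = δ Dφ s + ρ s`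
  have hρ : ∀ s : Site 2, ‖Y s - (δ : ℂ) * Dφ s‖ ≤
      if (δ : ℂ) * triEmbed s ∈ cthickening δ (tsupport φ) then 24 * M * δ ^ 2 else 0 := by
    intro s
    have h := frame_taylor_indicator hM w hw A B hframe ((δ : ℂ) * triEmbed s) hδ.le
    have hcs : ∀ k, c (s - spoke 0 k) = φ ((δ : ℂ) * triEmbed s - (δ : ℂ) * triEmbed (spoke 0 k)) := by
      intro k; simp only [hc, Literature.Probability.LatticeModels.triEmbed_sub, mul_sub]
    simp only [hY, hcs]
    convert h using 2
  -- (4) combine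
  have hsplit : (δ : ℂ)⁻¹ * ∑ s ∈ T, hh s * (Y s - (δ : ℂ) * Dφ s) =
      (δ : ℂ)⁻¹ * ∑ s ∈ T, hh s * Y s - ∑ s ∈ T, hh s * Dφ s := by
    have hδ0 : (δ : ℂ) ≠ 0 := Complex.ofReal_ne_zero.2 hδ.ne'
    simp only [mul_sub, Finset.sum_sub_distrib]
    congr 1
    rw [Finset.mul_sum]
    exact Finset.sum_congr rfl fun s _ => by field_simp
  have hmain : X + ∑ s ∈ T, hh s * Dφ s =
      (X - X₀) - (δ : ℂ)⁻¹ * ∑ s ∈ T, hh s * (Y s - (δ : ℂ) * Dφ s) := by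
    rw [hsplit, hAbel]; ring
  rw [hmain]
  refine (norm_sub_le _ _).trans (add_le_add (hXX₀ ▸ hE₁) ?_)
  rw [norm_mul, norm_inv, Complex.norm_real, Real.norm_eq_abs, abs_of_pos hδ]
  calc δ⁻¹ * ‖∑ s ∈ T, hh s * (Y s - (δ : ℂ) * Dφ s)‖
      ≤ δ⁻¹ * ∑ s ∈ T, (24 * M * δ ^ 2) *
          (if (δ : ℂ) * triEmbed s ∈ cthickening δ (tsupport φ) then ‖hh s‖ else 0) := by
        gcongr
        refine (norm_sum_le _ _).trans (Finset.sum_le_sum fun s _ => ?_)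
        rw [norm_mul]
        have h := hρ s
        split_ifs at h ⊢ with hs
        · rw [mul_comm]; exact mul_le_mul_of_nonneg_right h (norm_nonneg _)
        · have h0 : ‖Y s - (δ : ℂ) * Dφ s‖ = 0 := le_antisymm h (norm_nonneg _)
          rw [h0]; simp
    _ = 24 * M * δ * ∑ s ∈ T,
          (if (δ : ℂ) * triEmbed s ∈ cthickening δ (tsupport φ) then ‖hh s‖ else 0) := by
        rw [← Finset.mul_sum]; field_simp

/-- **Registered helper `developingMapLimitHolomorphic_byParts`** (crux stmt-CriticalPhenomena-14004,
line `pick-half-plane`, stub `stub_developingMapLimitHolomorphic`): registry form (one `∀`-term,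
classical decidability) of `byParts_estimate`. [folklore] -/
theorem developingMapLimitHolomorphic_byParts : ∀ (S : Finset HexVertex) (T : Finset (Fin 2 → ℤ)) (G : Sym2 HexVertex → ℂ) (hh : (Fin 2 → ℤ) → ℂ) (φ : ℂ → ℂ) (L : NNReal) (M δ : ℝ) (w : Fin 6 → ℂ) (A B : ℂ), (∀ (s : Fin 2 → ℤ) (k : Fin 6), IsInteriorSite S s → hh (spoke s k) - hh s = mvec k * ((δ : ℂ) * G (HexKernel.edge s k))) → LipschitzWith L φ → (∀ z h : ℂ, ‖φ (z + h) - φ z - fderiv ℝ φ z h‖ ≤ M * ‖h‖ ^ 2) → (∀ k : Fin 6, ‖w k‖ ≤ 1) → (∀ P Q : ℂ, ∑ k : Fin 6, w k * (12 * (starRingEnd ℂ) (mvec k)) * (P * triEmbed (spoke 0 k) + Q * (starRingEnd ℂ) (triEmbed (spoke 0 k))) = A * P + B * Q) → 0 < δ → (∀ s : Fin 2 → ℤ, (δ : ℂ) * triEmbed s ∈ Metric.cthickening δ (tsupport φ) → IsInteriorSite S s ∧ s ∈ T ∧ ∀ k : Fin 6, spoke s k ∈ T) → ‖∑ s ∈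 T, ∑ k : Fin 6, φ ((δ : ℂ) * hexMidpoint (HexKernel.edge s k)) * w k * G (HexKernel.edge s k) + ∑ s ∈ T, hh s * (A * ((2 : ℂ)⁻¹ * (fderiv ℝ φ ((δ : ℂ) * triEmbed s) 1 - Complex.I * fderiv ℝ φ ((δ : ℂ) * triEmbed s) Complex.I)) + B * Literature.Analysis.Complex.dbarAlong 1 φ ((δ : ℂ) * triEmbed s))‖ ≤ (L : ℝ) * δ / 2 * ∑ s ∈ T, ∑ k : Fin 6, (if (δ : ℂ) * hexMidpoint (HexKernel.edge s k) ∈ Metric.cthickening δ (tsupport φ) then ‖G (HexKernel.edge s k)‖ else 0) + 24 * M * δ * ∑ s ∈ T, (if (δ : ℂ) * triEmbed s ∈ Metric.cthickening δ (tsupport φ) then ‖hh s‖ else 0) :=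
  fun S T G hh φ _ _ _ w A B hHF hL hM hw hframe hδ hT =>
    byParts_estimate S T G hh φ w A B hHF hL hM hw hframe hδ hT

end Summit.CriticalPhenomena.SAWScalingLimit.Theorems.PickHalfPlane.DevelopingMap

end
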